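import Mathlib
import Summits.MatrixMultiplication.MatrixMultiplication.Theorems.FidelityWitnessesRankTwoAdditivityNorms

/-!
# `FidelityWitnesses.RankTwoAdditivity` (stmt-MatrixMultiplication-4964) — weak duality for the core inequality

The core four-matrix inequality (CORE, see the Reduction file) for arrays `X₁,X₂ ∈ ℂ^{ι×κ}`, `Y₁,Y₂ ∈ ℂ^{κ×μ}`
follows from a **2×2 certificate**: a Hermitian `ζ = [[z₁₁, conj z₂₁],[z₂₁, z₂₂]]` such that
`ζ ⊗ I_κ ⪰ 𝐍̃`, where `𝐍̃ = [[c₁ Y₁Y₁*, -p (Y₂Y₁*)*],[-p̄ Y₂Y₁*, c₂ Y₂Y₂*]]` (an inequality of Hermitian forms on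
`ℂ^κ ⊕ ℂ^κ`, hypothesis `hLMI` below, stated pointwise), together with the trace bound
`z₁₁‖X₁‖² + z₂₂‖X₂‖² + 2 Re(z₂₁ ⟨X₁,X₂⟩) ≤ β` (`htr`).  Pairing the form inequality with the Gram data of the rows of
`[X₁ X₂]` and summing (weak SDP duality, written out as finite sums) gives
`c₁‖X₁Y₁‖² + c₂‖X₂Y₂‖² - 2 Re(p̄ ⟨X₁Y₁, X₂Y₂⟩) ≤ β`.
With `c₁ = ‖X₂‖²‖Y₂‖²`, `c₂ = ‖X₁‖²‖Y₁‖²`, `p = ⟨X₁,X₂⟩⟨Y₁,Y₂⟩`, `β = 2 n₁ n₂ - 2|p|²` this is exactly CORE.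
Supports item `stmt-MatrixMultiplication-4964`; no definitions are introduced.
-/

namespace Summit.MatrixMultiplication.MatrixMultiplication.Theorems.RankTwoAdditivity

open scoped BigOperators ComplexConjugate

/-- **Weak duality for CORE.** If the Hermitian form
`ψ ↦ c₁‖Y₁*ψ₁‖² + c₂‖Y₂*ψ₂‖² − 2Re(p̄⟨Y₂*ψ₂, Y₁*ψ₁⟩)` on `ℂ^κ ⊕ ℂ^κ` is dominated by the form of
`ζ ⊗ I` (`hLMI`), then pairing with the rows of `X₁, X₂` bounds
`c₁‖X₁Y₁‖² + c₂‖X₂Y₂‖² − 2Re(p̄⟨X₁Y₁,X₂Y₂⟩)` by `z₁₁‖X₁‖² + z₂₂‖X₂‖² + 2Re(z₂₁⟨X₁,X₂⟩)`. [folklore] -/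
theorem weak_duality {ι κ μ : Type*} [Fintype ι] [Fintype κ] [Fintype μ]
    (u₁ u₂ : ι × κ → ℂ) (v₁ v₂ : κ × μ → ℂ) (A B : ι × μ → ℂ)
    (hA : ∀ a, A a = ∑ m, u₁ (a.1, m) * v₁ (m, a.2))
    (hB : ∀ a, B a = ∑ m, u₂ (a.1, m) * v₂ (m, a.2))
    (c₁ c₂ z₁₁ z₂₂ : ℝ) (p z₂₁ : ℂ)
    (hLMI : ∀ ψ₁ ψ₂ : κ → ℂ,
      c₁ * (∑ c, ‖∑ m, conj (v₁ (m, c)) * ψ₁ m‖ ^ 2)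
        + c₂ * (∑ c, ‖∑ m, conj (v₂ (m, c)) * ψ₂ m‖ ^ 2)
        - 2 * (conj p * ∑ c, conj (∑ m, conj (v₂ (m, c)) * ψ₂ m) * ∑ m, conj (v₁ (m, c)) * ψ₁ m).re
      ≤ z₁₁ * (∑ m, ‖ψ₁ m‖ ^ 2) + z₂₂ * (∑ m, ‖ψ₂ m‖ ^ 2)
        + 2 * (z₂₁ * ∑ m, conj (ψ₂ m) * ψ₁ m).re) :
    c₁ * (∑ a, ‖A a‖ ^ 2) + c₂ * (∑ a, ‖B a‖ ^ 2)
        - 2 * (conj p * ∑ a, conj (A a) * B a).re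
      ≤ z₁₁ * (∑ b, ‖u₁ b‖ ^ 2) + z₂₂ * (∑ b, ‖u₂ b‖ ^ 2)
        + 2 * (z₂₁ * ∑ b, conj (u₁ b) * u₂ b).re := by
  -- instantiate the form inequality at the conjugate rows of `X₁, X₂` and sum over the rows
  have key := fun i : ι => hLMI (fun m => conj (u₁ (i, m))) (fun m => conj (u₂ (i, m)))
  have hsum := Finset.sum_le_sum fun i (_ : i ∈ Finset.univ) => key i
  -- identify the row-`i` pieces
  have hA' : ∀ i c, (∑ m, conj (v₁ (m, c)) * conj (u₁ (i, m))) = conj (A (i, c)) := by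
    intro i c; rw [hA, map_sum]
    exact Finset.sum_congr rfl fun m _ => by rw [map_mul, mul_comm]
  have hB' : ∀ i c, (∑ m, conj (v₂ (m, c)) * conj (u₂ (i, m))) = conj (B (i, c)) := by
    intro i c; rw [hB, map_sum]
    exact Finset.sum_congr rfl fun m _ => by rw [map_mul, mul_comm]
  simp only [hA', hB', Complex.norm_conj, Complex.conj_conj] at hsum
  -- rewrite the four global sums over `ι × μ` / `ι × κ` as iterated sums
  have h1 : (∑ a, ‖A a‖ ^ 2) = ∑ i, ∑ c, ‖A (i, c)‖ ^ 2 := Fintype.sum_prod_type _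
  have h2 : (∑ a, ‖B a‖ ^ 2) = ∑ i, ∑ c, ‖B (i, c)‖ ^ 2 := Fintype.sum_prod_type _
  have h3 : (∑ a, conj (A a) * B a) = ∑ i, ∑ c, B (i, c) * conj (A (i, c)) := by
    rw [Fintype.sum_prod_type]
    exact Finset.sum_congr rfl fun i _ => Finset.sum_congr rfl fun c _ => mul_comm _ _
  have h4 : (∑ b, ‖u₁ b‖ ^ 2) = ∑ i, ∑ m, ‖u₁ (i, m)‖ ^ 2 := Fintype.sum_prod_type _
  have h5 : (∑ b, ‖u₂ b‖ ^ 2) = ∑ i, ∑ m, ‖u₂ (i, m)‖ ^ 2 := Fintype.sum_prod_type _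
  have h6 : (∑ b, conj (u₁ b) * u₂ b) = ∑ i, ∑ m, u₂ (i, m) * conj (u₁ (i, m)) := by
    rw [Fintype.sum_prod_type]
    exact Finset.sum_congr rfl fun i _ => Finset.sum_congr rfl fun m _ => mul_comm _ _
  rw [h1, h2, h3, h4, h5, h6]
  -- distribute everything into a single sum over `i` on both sides and compare with `hsum`
  have eL : c₁ * (∑ i, ∑ c, ‖A (i, c)‖ ^ 2) + c₂ * (∑ i, ∑ c, ‖B (i, c)‖ ^ 2)
      - 2 * (conj p * ∑ i, ∑ c, B (i, c) * conj (A (i, c))).re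
      = ∑ i, (c₁ * ∑ c, ‖A (i, c)‖ ^ 2 + c₂ * ∑ c, ‖B (i, c)‖ ^ 2
          - 2 * (conj p * ∑ c, B (i, c) * conj (A (i, c))).re) := by
    rw [Finset.sum_sub_distrib, Finset.sum_add_distrib, Finset.mul_sum, Finset.mul_sum,
      Finset.mul_sum, Complex.re_sum, Finset.mul_sum]
  have eR : z₁₁ * (∑ i, ∑ m, ‖u₁ (i, m)‖ ^ 2) + z₂₂ * (∑ i, ∑ m, ‖u₂ (i, m)‖ ^ 2)
      + 2 * (z₂₁ * ∑ i, ∑ m, u₂ (i, m) * conj (u₁ (i, m))).re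
      = ∑ i, (z₁₁ * ∑ m, ‖u₁ (i, m)‖ ^ 2 + z₂₂ * ∑ m, ‖u₂ (i, m)‖ ^ 2
          + 2 * (z₂₁ * ∑ m, u₂ (i, m) * conj (u₁ (i, m))).re) := by
    rw [Finset.sum_add_distrib, Finset.sum_add_distrib, Finset.mul_sum, Finset.mul_sum,
      Finset.mul_sum, Complex.re_sum, Finset.mul_sum]
  rw [eL, eR]
  exact hsum

/-- **CORE from a certificate.** With the weights `c₁ = ‖X₂‖²‖Y₂‖²`, `c₂ = ‖X₁‖²‖Y₁‖²`, `p = ⟨X₁,X₂⟩⟨Y₁,Y₂⟩`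
in `weak_duality` and the trace bound `z₁₁‖X₁‖² + z₂₂‖X₂‖² + 2Re(z₂₁⟨X₁,X₂⟩) ≤ 2n₁n₂ − 2|p|²`, the core
four-matrix inequality (CORE) follows. [folklore] -/
theorem core_of_certificate {ι κ μ : Type*} [Fintype ι] [Fintype κ] [Fintype μ]
    (u₁ u₂ : ι × κ → ℂ) (v₁ v₂ : κ × μ → ℂ) (A B : ι × μ → ℂ)
    (hA : ∀ a, A a = ∑ m, u₁ (a.1, m) * v₁ (m, a.2))
    (hB : ∀ a, B a = ∑ m, u₂ (a.1, m) * v₂ (m, a.2))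
    (z₁₁ z₂₂ : ℝ) (z₂₁ : ℂ)
    (hLMI : ∀ ψ₁ ψ₂ : κ → ℂ,
      ((∑ b, ‖u₂ b‖ ^ 2) * ∑ c, ‖v₂ c‖ ^ 2) * (∑ c, ‖∑ m, conj (v₁ (m, c)) * ψ₁ m‖ ^ 2)
        + ((∑ b, ‖u₁ b‖ ^ 2) * ∑ c, ‖v₁ c‖ ^ 2) * (∑ c, ‖∑ m, conj (v₂ (m, c)) * ψ₂ m‖ ^ 2)
        - 2 * (conj ((∑ b, conj (u₁ b) * u₂ b) * ∑ c, conj (v₁ c) * v₂ c)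
            * ∑ c, conj (∑ m, conj (v₂ (m, c)) * ψ₂ m) * ∑ m, conj (v₁ (m, c)) * ψ₁ m).re
      ≤ z₁₁ * (∑ m, ‖ψ₁ m‖ ^ 2) + z₂₂ * (∑ m, ‖ψ₂ m‖ ^ 2)
        + 2 * (z₂₁ * ∑ m, conj (ψ₂ m) * ψ₁ m).re)
    (htr : z₁₁ * (∑ b, ‖u₁ b‖ ^ 2) + z₂₂ * (∑ b, ‖u₂ b‖ ^ 2)
        + 2 * (z₂₁ * ∑ b, conj (u₁ b) * u₂ b).re
      ≤ 2 * ((∑ b, ‖u₁ b‖ ^ 2) * ∑ c, ‖v₁ c‖ ^ 2) * ((∑ b, ‖u₂ b‖ ^ 2) * ∑ c, ‖v₂ c‖ ^ 2)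
        - 2 * ‖(∑ b, conj (u₁ b) * u₂ b) * ∑ c, conj (v₁ c) * v₂ c‖ ^ 2) :
    ((∑ b, ‖u₁ b‖ ^ 2) * ∑ c, ‖v₁ c‖ ^ 2) * (∑ a, ‖B a‖ ^ 2)
      + ((∑ b, ‖u₂ b‖ ^ 2) * ∑ c, ‖v₂ c‖ ^ 2) * (∑ a, ‖A a‖ ^ 2)
      + 2 * ‖(∑ b, conj (u₁ b) * u₂ b) * ∑ c, conj (v₁ c) * v₂ c‖ ^ 2
    ≤ 2 * ((∑ b, ‖u₁ b‖ ^ 2) * ∑ c, ‖v₁ c‖ ^ 2) * ((∑ b, ‖u₂ b‖ ^ 2) * ∑ c, ‖v₂ c‖ ^ 2)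
      + 2 * (conj ((∑ b, conj (u₁ b) * u₂ b) * ∑ c, conj (v₁ c) * v₂ c)
              * ∑ a, conj (A a) * B a).re := by
  have h := weak_duality u₁ u₂ v₁ v₂ A B hA hB _ _ z₁₁ z₂₂ _ z₂₁ hLMI
  linarith

end Summit.MatrixMultiplication.MatrixMultiplication.Theorems.RankTwoAdditivity
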